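import Mathlib
import HarnessLib
import Literature.AlgebraicGeometry.Motives.AbelianVarietyProduct
import Literature.AlgebraicGeometry.HodgeTheory.WeilClassesTwistedSquare

/-!
# The twisted square `(T × T, φ × (−φ))` is `K`-isogenous to the SPLIT square `(T × T, (x, y) ↦ (−d·y, x))` = «`T ⊗ ℤ[√−d]`»
# (route `KleimanBFSeeds`, crux K2ᵀ 28148 — anchor bookkeeping for `PureWeilSeedOnTwistedSquare`, typed)

HONEST FRAMING: HELPER lemmas `--supports stmt-HodgeConjecture-28148` (crux `TwistNormalisedKleimanSemiregularAnchor`,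
registered rung `stub_rung_CMclass_d3 : KleimanAnchorRungCM 3` of `Cruxes/TwistNormalisedKleimanSemiregularAnchor/Lines/chosen_anchor.lean`,
whose door `PureWeilSeedOnTwistedSquare C d` quantifies over twisted squares `(T × T, Φ = φ × (−φ))`, `φ ≫ φ = −d`). Three
identities in the preadditive category `AbelianVariety ℂ` (tree: `Motives/AbelianVariety`, `Motives/AbelianVarietyProduct`),
kernel-checked; nothing here proves the rung, K2ᵀ, `WeilSixfolds`, HC_AV, HC_CM or HC.

CONTENT. For an abelian variety `T` with `φ : T ⟶ T`, `φ ≫ φ = −(d·𝟙)`, put on `T × T`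
* `Φ := (p₁ ≫ φ, p₂ ≫ (−φ))` — the TWISTED square structure of the skeleton (`√−d` acts by `φ` on the first and by `−φ` on the
  second factor; `Φ ≫ Φ = −d`, tree `twistedSquare_comp_self`);
* `η := (p₂ ≫ (−d·𝟙), p₁)`, `(x, y) ↦ (−d·y, x)` — the SPLIT structure «`T ⊗_ℤ ℤ[√−d]`» (`√−d · (x ⊗ 1 + y ⊗ √−d) = −d·y ⊗ 1 + x ⊗ √−d`),
  which is, after `T̂ ≅ T` by a principal polarisation, the structure `η(√−q) = (0, −q·A; A⁻¹, 0)` of Markman's secant-sheaf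
  sixfolds `X × X̂` [Markman2025SurveySecant, Example 5.1 and §11.1];
* `α := ((p₁ − p₂) ≫ φ, p₁ + p₂)`, `(y₁, y₂) ↦ (φ(y₁ − y₂), y₁ + y₂)` and `β := (p₂ ≫ d·𝟙 − p₁ ≫ φ, p₂ ≫ d·𝟙 + p₁ ≫ φ)`,
  `(u, v) ↦ (d·v − φu, d·v + φu)`.
Then **`Φ ≫ α = α ≫ η`** (`twistedSquare_comp_toSplit`: `α` is `K`-LINEAR from `(T × T, Φ)` to `(T × T, η)`), and
**`α ≫ β = 2d·𝟙`, `β ≫ α = 2d·𝟙`** (`toSplit_comp_fromSplit`, `fromSplit_comp_toSplit`): `α` and `β` are mutually inverse up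
to the isogeny `[2d]`, so every twisted-square anchor of the line is, AS A `K`-ABELIAN VARIETY, of split type `T ⊗ K`
(`K = ℚ(√−d)`). The cells `[−b]` of the rung are therefore distinguished on ONE `K`-variety by the POLARISATION `Θ₁ + b·Θ₂`
only (pen side: `α^*(Θ₁ + d·Θ₂) = 2d·(Θ₁ + Θ₂)`, the split class `b = 1`; crux workfile `MARKMAN-TRANSPORT-LANDHERR-rung1-g4.md`).
Proofs: the universal property of `T × T` (`prod_hom_ext`, `prodLift_fst ∕ _snd`) and bilinearity of composition.

References: [Markman2025SurveySecant] E. Markman, Secant sheaves and Weil classes on abelian varieties, arXiv:2509.23403,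
Example 5.1, §11.1; [vanGeemen1994HodgeAV] B. van Geemen, An introduction to the Hodge conjecture for abelian varieties,
LNM 1594, 5.3 (twisted products). Tree: `Motives/AbelianVarietyProduct` (`prodLift`, `fst`, `snd`, `prod_hom_ext`),
`HodgeTheory/WeilClassesTwistedSquare` (`twistedSquare_comp_self`).
-/

-- every declaration of this problem lives in `Summit.HodgeConjecture.HodgeConjecture.…` (summit = sub-problem)
set_option linter.dupNamespace false

noncomputable section

open CategoryTheory

namespace Summit.HodgeConjecture.HodgeConjecture.Theorems

open Literature.AlgebraicGeometry.Motives
open Literature.AlgebraicGeometry.Motives.AbelianVariety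

variable {T : AbelianVariety ℂ} {φ : T ⟶ T} {d : ℕ}

/-- **The twisted square maps `K`-linearly to the split square**: with `Φ = (p₁ ≫ φ, p₂ ≫ (−φ))`, `η = (p₂ ≫ (−d·𝟙), p₁)` and
`α = ((p₁ − p₂) ≫ φ, p₁ + p₂)` on `T × T`, `Φ ≫ α = α ≫ η` whenever `φ ≫ φ = −d·𝟙`
(`(y₁, y₂) ↦ (−d(y₁ + y₂), φ(y₁ − y₂))` both ways). [cite: Markman2025SurveySecant, Example 5.1 and §11.1]
[cite: vanGeemen1994HodgeAV, 5.3] -/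
theorem twistedSquare_comp_toSplit (hφ : φ ≫ φ = -(d • 𝟙 T)) :
    prodLift (fst T T ≫ φ) (snd T T ≫ (-φ)) ≫ prodLift ((fst T T - snd T T) ≫ φ) (fst T T + snd T T) =
      prodLift ((fst T T - snd T T) ≫ φ) (fst T T + snd T T) ≫
        prodLift (snd T T ≫ (-(d • 𝟙 T))) (fst T T) := by
  apply prod_hom_ext <;>
  · simp only [Category.assoc, prodLift_fst, prodLift_snd, prodLift_fst_assoc, prodLift_snd_assoc,
      Preadditive.comp_sub, Preadditive.sub_comp, Preadditive.comp_add, Preadditive.comp_neg, Preadditive.neg_comp,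
      Preadditive.comp_nsmul, Category.comp_id, hφ, neg_neg, smul_add]
    abel

/-- **`α ≫ β = 2d·𝟙`** for `β = (p₂ ≫ d·𝟙 − p₁ ≫ φ, p₂ ≫ d·𝟙 + p₁ ≫ φ)`: `β(α(y₁, y₂)) = (d(y₁+y₂) − φ²(y₁−y₂), d(y₁+y₂) + φ²(y₁−y₂))
= (2d·y₁, 2d·y₂)`. [cite: vanGeemen1994HodgeAV, 5.3] -/
theorem toSplit_comp_fromSplit (hφ : φ ≫ φ = -(d • 𝟙 T)) :
    prodLift ((fst T T - snd T T) ≫ φ) (fst T T + snd T T) ≫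
        prodLift (snd T T ≫ (d • 𝟙 T) - fst T T ≫ φ) (snd T T ≫ (d • 𝟙 T) + fst T T ≫ φ) =
      (2 * d) • 𝟙 (T.prod T) := by
  apply prod_hom_ext <;>
  · simp only [Category.assoc, prodLift_fst, prodLift_snd, prodLift_fst_assoc,
      Preadditive.comp_sub, Preadditive.sub_comp, Preadditive.comp_add, Preadditive.add_comp, Preadditive.comp_neg,
      Preadditive.comp_nsmul, Preadditive.nsmul_comp, Category.comp_id, Category.id_comp, hφ,
      mul_nsmul, two_nsmul, sub_neg_eq_add, smul_add]
    abel

/-- **`β ≫ α = 2d·𝟙`**: `α(β(u, v)) = (φ(−2φu), 2d·v) = (2d·u, 2d·v)`. So `α` is a `K`-linear isogeny from the twisted square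
onto the split square, with quasi-inverse `β` (degree bookkeeping: `ker α ≅ T[2φ]`). [cite: vanGeemen1994HodgeAV, 5.3] -/
theorem fromSplit_comp_toSplit (hφ : φ ≫ φ = -(d • 𝟙 T)) :
    prodLift (snd T T ≫ (d • 𝟙 T) - fst T T ≫ φ) (snd T T ≫ (d • 𝟙 T) + fst T T ≫ φ) ≫
        prodLift ((fst T T - snd T T) ≫ φ) (fst T T + snd T T) =
      (2 * d) • 𝟙 (T.prod T) := by
  apply prod_hom_ext <;>
  · simp only [Category.assoc, prodLift_fst, prodLift_snd, prodLift_fst_assoc, prodLift_snd_assoc,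
      Preadditive.comp_sub, Preadditive.sub_comp, Preadditive.comp_add, Preadditive.add_comp, Preadditive.comp_neg,
      Preadditive.comp_nsmul, Preadditive.nsmul_comp, Category.comp_id, Category.id_comp, hφ,
      mul_nsmul, two_nsmul, sub_neg_eq_add, smul_add]
    abel

end Summit.HodgeConjecture.HodgeConjecture.Theorems

end
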